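import Summits.BirchSwinnertonDyer.BirchSwinnertonDyer.Theorems.QuadraticBranchSignedControlPlusEtaLowerInclusionTamagawaRoadCount
import Summits.BirchSwinnertonDyer.BirchSwinnertonDyer.Theorems.QuadraticBranchSignedControlPlusEtaLowerInclusionTamagawaRoadDuality
import Summits.BirchSwinnertonDyer.BirchSwinnertonDyer.Theorems.QuadraticBranchSignedControlPlusEtaLowerInclusionValuationSqueezeTorsion
import Literature.NumberTheory.EllipticCurves.KatoRankBoundProofs
import Literature.NumberTheory.EllipticCurves.IwasawaCoinvariantsRankProofs
import HarnessLib

/-!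
# Route `QuadraticBranchSignedControl` (rung K8, cell `bsd-potss`), crux `PlusEtaLowerInclusion`
# (item stmt-BirchSwinnertonDyer-19601): the TAMAGAWA ROAD at level `p^k` — (E⁺_η) at a tower-onto pair
# from `v + k·r ≤ ∑_{ℓ ∈ T} ord_p c_ℓ(W)` with `ord_p c_ℓ(W) ≤ k` on `T` (seat `bsd-potss-k8eta-c1` g4)

WHAT. The sibling `…TamagawaRoad` runs g3's Tamagawa road at level `p` (forcing `ord_p c_ℓ(W) ≤ 1`);
parts 1–2 being level-generic, THIS FILE supplies the `p^k` algebra and reruns the assembly at level `p^k`: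
* §1 (algebra over `ℤ_p`) `natCard_modN_pi_pow`, `natCard_modN_pow_le` (**`#(N/p^kN) ≤ p^{k·rank N}·#N_{tors}`**,
  `N/p^kN ↠ L/p^kL` for the free quotient `L = N/N_tors`), `natCard_torsionBy_pow_le_pow_finrank_mul_natCard_torsion`
  (**`#S[p^k] ≤ p^{k·rank N}·#N_tors`** when `N ≅ Hom(S, ℚ/ℤ)` is finitely generated over `ℤ_p`).
* §2 `…_of_tamagawa_level`: (E⁺_η)(V, p) from the named facts (Kobayashi 1.2/1.3/2.2η/4.1η, Kitajima–Otsuki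
  1.3η, Poitou–Tate) + tower onto + `V`-certificate + `p^{v+1} ∤ coeff_r L_p⁺(V,η,T)` + the arithmetic
  input **`v + k·r ≤ ∑_{ℓ ∈ T} ord_p c_ℓ(W)`** (`T ∌ (p)` ⊇ every `ℓ ≠ p` with `p ∣ c_ℓ(W)`, `ord_p c_ℓ(W) ≤ k`
  on `T`, `k ≥ 1`, `r = rank V^{(p*)}(ℚ)`); `k = 1` is the sibling. For `r = 1`, `T = {ℓ₁, ℓ₂}`,
  `ord_p c_{ℓ_i} = k`: `v ≤ k` — the Cassels bound `#(K_Tam ∩ im λ) ≥ #K_Tam/exp K_Tam` of g3's memo §D.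

HONEST FRAMING (cell `bsd-potss`, run/shared/lean/pub/bsd-potss/; FULL-BSD rank ≤ 1 programme, HUMAN
RULING D-0036/D-0074): TOOL THEOREMS ONLY, CONDITIONAL on the named Literature facts in hypothesis
position, the tower-onto hypothesis, the `V`-certificate, the analytic certificate (supplied for NO pair)
and the displayed Tamagawa inequality. The crux 19601 is OPEN and NOT closed; no row is certified in the
kernel; nothing is booked; `BSD(W, p)` is claimed for no pair. No definition, no named fact, no `sorry`,
axioms standard. `--supports stmt-BirchSwinnertonDyer-19601`.

References: [Kobayashi2003] Thm. 2.2 (p. 5), §4 + Thm. 4.1 (p. 8), Thm. 9.3 (pp. 26–27);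
[KitajimaOtsuki2018] Thm. 1.3; [MilneADT2006] I Thm. 4.10; [GreenbergLNM1716] §1 p. 60, §3–§4;
[CoatesSchneiderSujatha2003] §3 (30)–(31).
-/

set_option autoImplicit false
set_option linter.dupNamespace false

noncomputable section

open scoped Classical AddSubgroup

open CongruenceSubgroup Field NumberField IsDedekindDomain WeierstrassCurve
open Literature.NumberTheory.EllipticCurves
open Literature.NumberTheory.EllipticCurves.ModularForms
open Literature.NumberTheory.GaloisRepresentations
open Literature.NumberTheory.GaloisCohomology
open Literature.NumberTheory.EllipticCurves.IwasawaDual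
open Literature.NumberTheory.EllipticCurves.IwasawaAlgebra
open Summit.BirchSwinnertonDyer.Rank1Residual.Additive

namespace Summit.BirchSwinnertonDyer.BirchSwinnertonDyer.Theorems

namespace TamagawaRoad

/-! ## §1 Pontryagin bookkeeping over `ℤ_p` at level `p^k` -/

section Algebra

variable (p : ℕ) [hp : Fact p.Prime] (k : ℕ)

/-- `#((ℤ_p^ι)/p^k) = p ^ (k · #ι)` (`PadicInt.toZModPow k` componentwise: onto, kernel `p^k ℤ_p^ι`). [folklore] -/
theorem natCard_modN_pi_pow (ι : Type*) [Fintype ι] :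
    Nat.card (ModN (ι → ℤ_[p]) (p ^ k)) = p ^ (k * Fintype.card ι) := by
  let φ : (ι → ℤ_[p]) →+ (ι → ZMod (p ^ k)) :=
    AddMonoidHom.pi fun i ↦ (PadicInt.toZModPow (p := p) k).toAddMonoidHom.comp
      (Pi.evalAddMonoidHom (fun _ ↦ ℤ_[p]) i)
  have hφ : ∀ w i, φ w i = PadicInt.toZModPow k (w i) := fun _ _ ↦ rfl
  have hsurj : Function.Surjective φ := by
    intro v
    refine ⟨fun i ↦ ((v i).val : ℤ_[p]), funext fun i ↦ ?_⟩
    rw [hφ, map_natCast, ZMod.natCast_zmod_val]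
  have hker : φ.ker = (LinearMap.range (LinearMap.lsmul ℤ (ι → ℤ_[p]) (p ^ k : ℕ))).toAddSubgroup := by
    ext w
    simp only [AddMonoidHom.mem_ker, Submodule.mem_toAddSubgroup, LinearMap.mem_range,
      LinearMap.lsmul_apply]
    constructor
    · intro hw
      have hw' : ∀ i, ∃ a : ℤ_[p], a * (p : ℤ_[p]) ^ k = w i := fun i ↦ by
        have hi : PadicInt.toZModPow k (w i) = 0 := by rw [← hφ, hw]; rfl
        rw [← RingHom.mem_ker, PadicInt.ker_toZModPow] at hi
        exact Ideal.mem_span_singleton'.mp hi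
      choose a ha using hw'
      refine ⟨a, funext fun i ↦ ?_⟩
      rw [Pi.smul_apply, ← ha i, zsmul_eq_mul, Int.cast_natCast, Nat.cast_pow, mul_comm]
    · rintro ⟨y, rfl⟩
      funext i
      rw [hφ, Pi.smul_apply, zsmul_eq_mul, Int.cast_natCast, map_mul, map_natCast, ZMod.natCast_self,
        zero_mul]
      rfl
  have e : ModN (ι → ℤ_[p]) (p ^ k) ≃+ (ι → ZMod (p ^ k)) :=
    (QuotientAddGroup.quotientAddEquivOfEq hker.symm).trans
      (QuotientAddGroup.quotientKerEquivOfSurjective φ hsurj)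
  rw [Nat.card_congr e.toEquiv, Nat.card_fun, Nat.card_zmod, Nat.card_eq_fintype_card, ← pow_mul]

variable (N : Type*) [AddCommGroup N] [Module ℤ_[p] N] [Module.Finite ℤ_[p] N]

/-- **`#(N/p^kN) ≤ p^{k·rank N} · #N_tors`** (`N` finitely generated over `ℤ_p`; `N/p^kN` finite):
`N/p^kN ↠ L/p^kL`, `L = N/N_tors` free, kernel = image of `N_tors`. Twin of `ZpCorank.natCard_modN_le`. [folklore] -/
theorem natCard_modN_pow_le :
    Finite (ModN N (p ^ k)) ∧
      Nat.card (ModN N (p ^ k)) ≤ p ^ (k * Module.finrank ℤ_[p] N) * Nat.card (Submodule.torsion ℤ_[p] N) := by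
  set T := Submodule.torsion ℤ_[p] N with hT
  haveI : Finite T := ZpCorank.finite_torsion p N
  let L := N ⧸ T
  have hrank : Module.finrank ℤ_[p] L = Module.finrank ℤ_[p] N :=
    finrank_quotient_eq_of_le_torsion (le_refl _)
  -- the induced map `N/p^kN → L/p^kL`
  have hle : (LinearMap.range (LinearMap.lsmul ℤ N (p ^ k : ℕ))).toAddSubgroup ≤
      ((LinearMap.range (LinearMap.lsmul ℤ L (p ^ k : ℕ))).toAddSubgroup).comap T.mkQ.toAddMonoidHom := by
    rintro _ ⟨y, rfl⟩
    refine ⟨T.mkQ y, ?_⟩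
    simp only [LinearMap.lsmul_apply, LinearMap.toAddMonoidHom_coe, map_zsmul]
  let π : ModN N (p ^ k) →+ ModN L (p ^ k) := QuotientAddGroup.map _ _ T.mkQ.toAddMonoidHom hle
  have hπ : ∀ n : N, π (ModN.mkQ (p ^ k) n) = ModN.mkQ (p ^ k) (T.mkQ n) := fun _ ↦ rfl
  have hπsurj : Function.Surjective π := by
    intro q
    induction q using QuotientAddGroup.induction_on with
    | H ℓ =>
      obtain ⟨n, rfl⟩ := T.mkQ_surjective ℓ
      exact ⟨ModN.mkQ (p ^ k) n, hπ n⟩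
  -- its kernel is the image of `T`
  let ψ := (ModN.mkQ (G := N) (p ^ k)).comp T.toAddSubgroup.subtype
  have hker : π.ker ≤ ψ.range := by
    intro q hq
    induction q using QuotientAddGroup.induction_on with
    | H n =>
      rw [AddMonoidHom.mem_ker] at hq
      change ModN.mkQ (p ^ k) (T.mkQ n) = 0 at hq
      have hq' : T.mkQ n ∈ LinearMap.range (LinearMap.lsmul ℤ L (p ^ k : ℕ)) := by
        rwa [ZpCorank.modN_mkQ_eq_zero_iff] at hq
      obtain ⟨ℓ, hℓ⟩ := hq'
      obtain ⟨n', rfl⟩ := T.mkQ_surjective ℓ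
      rw [LinearMap.lsmul_apply, ← map_zsmul, ← sub_eq_zero, ← map_sub, Submodule.mkQ_apply,
        Submodule.Quotient.mk_eq_zero] at hℓ
      have e : (QuotientAddGroup.mk n : ModN N (p ^ k)) =
          ψ ⟨-( ((p ^ k : ℕ) : ℤ) • n' - n), T.neg_mem hℓ⟩ + ModN.mkQ (p ^ k) (((p ^ k : ℕ) : ℤ) • n') := by
        change ModN.mkQ (p ^ k) n = ModN.mkQ (p ^ k) (-( ((p ^ k : ℕ) : ℤ) • n' - n)) +
          ModN.mkQ (p ^ k) (((p ^ k : ℕ) : ℤ) • n')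
        rw [← map_add]
        congr 1
        abel
      rw [e]
      refine add_mem ⟨_, rfl⟩ ?_
      have h0 : ModN.mkQ (p ^ k) (((p ^ k : ℕ) : ℤ) • n') = (0 : ModN N (p ^ k)) := by
        rw [ZpCorank.modN_mkQ_eq_zero_iff]
        exact ⟨n', rfl⟩
      rw [h0]
      exact zero_mem _
  haveI : Finite ψ.range := Finite.of_surjective _ ψ.rangeRestrict_surjective
  have hinj : Function.Injective (fun x : π.ker ↦ (⟨x.1, hker x.2⟩ : ψ.range)) :=
    fun x y hxy ↦ Subtype.ext (by simpa using congrArg Subtype.val hxy)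
  haveI : Finite π.ker := Finite.of_injective _ hinj
  have hcardker : Nat.card π.ker ≤ Nat.card T :=
    (Nat.card_le_card_of_injective _ hinj).trans
      (Nat.card_le_card_of_surjective _ ψ.rangeRestrict_surjective)
  have hcard : Nat.card (ModN N (p ^ k)) = Nat.card (ModN L (p ^ k)) * Nat.card π.ker := by
    rw [AddSubgroup.card_eq_card_quotient_mul_card_addSubgroup π.ker,
      Nat.card_congr (QuotientAddGroup.quotientKerEquivOfSurjective π hπsurj).toEquiv]
  have hL : Nat.card (ModN L (p ^ k)) = p ^ (k * Module.finrank ℤ_[p] N) := by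
    rw [Nat.card_congr (modNEquiv (Module.finBasis ℤ_[p] L).equivFun.toAddEquiv (p ^ k)).toEquiv,
      natCard_modN_pi_pow, Fintype.card_fin, hrank]
  refine ⟨?_, ?_⟩
  · refine Nat.finite_of_card_ne_zero ?_
    rw [hcard, hL]
    exact mul_ne_zero (pow_ne_zero _ hp.out.ne_zero) Nat.card_pos.ne'
  · rw [hcard, hL]
    exact Nat.mul_le_mul_left _ hcardker

/-- **`#S[p^k] ≤ p^{k·rank_{ℤ_p} N} · #N_tors` when `N ≅ Hom(S, ℚ/ℤ)` is finitely generated over `ℤ_p`**,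
and `S[p^k]` is finite: `Hom(S, ℚ/ℤ)/p^k ↠ Hom(S[p^k], ℚ/ℤ)` (`ℚ/ℤ` injective), `natCard_modN_pow_le`,
`N_{tors} ⊆ N_tors`, `#Hom(S[p^k], ℚ/ℤ) = #S[p^k]`. [cite: GreenbergLNM1716, §1 (p. 60)] -/
theorem natCard_torsionBy_pow_le_pow_finrank_mul_natCard_torsion
    {S : Type*} [AddCommGroup S] (Ψ : N ≃+ CharacterModule S) :
    Finite S[((p ^ k : ℕ) : ℤ)] ∧
      Nat.card S[((p ^ k : ℕ) : ℤ)] ≤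
        p ^ (k * Module.finrank ℤ_[p] N) * Nat.card (AddCommGroup.torsion N) := by
  obtain ⟨hNmod, hle⟩ := natCard_modN_pow_le p k N
  haveI := hNmod
  haveI hfinT : Finite (Submodule.torsion ℤ_[p] N) := ZpCorank.finite_torsion p N
  haveI hmodS : Finite (ModN (CharacterModule S) (p ^ k)) :=
    Finite.of_equiv _ (modNEquiv Ψ (p ^ k)).toEquiv
  -- the restriction `Hom(S, ℚ/ℤ)/p^k → Hom(S[p^k], ℚ/ℤ)` is onto
  let r : ModN (CharacterModule S) (p ^ k) →+ CharacterModule (S[((p ^ k : ℕ) : ℤ)]) :=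
    ModN.liftEquiv.symm
      ⟨(CharacterModule.dual ((S[((p ^ k : ℕ) : ℤ)]).subtype.toIntLinearMap)).toAddMonoidHom, fun χ ↦ by
        refine AddMonoidHom.ext fun b ↦ ?_
        show (p ^ k) • χ (b : S) = 0
        rw [← map_nsmul, ← AddSubgroupClass.coe_nsmul, AddSubgroup.torsionBy.nsmul b,
          ZeroMemClass.coe_zero, map_zero]⟩
  have hr : ∀ (χ : CharacterModule S) (b : S[((p ^ k : ℕ) : ℤ)]), r (ModN.mkQ (p ^ k) χ) b = χ b :=
    fun _ _ ↦ rfl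
  have hrsurj : Function.Surjective r := by
    intro χ'
    obtain ⟨χ, hχ⟩ := CharacterModule.dual_surjective_of_injective
      ((S[((p ^ k : ℕ) : ℤ)]).subtype.toIntLinearMap) (fun a b hab ↦ Subtype.ext hab) χ'
    refine ⟨ModN.mkQ (p ^ k) χ, ?_⟩
    refine CharacterModule.ext (A := ↥(S[((p ^ k : ℕ) : ℤ)])) fun b ↦ ?_
    rw [hr, ← hχ]
    rfl
  haveI hfinC : Finite (CharacterModule (S[((p ^ k : ℕ) : ℤ)])) := Finite.of_surjective r hrsurj
  haveI hfinS : Finite S[((p ^ k : ℕ) : ℤ)] := PontryaginCard.finite_of_finite_characterModule _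
  refine ⟨hfinS, ?_⟩
  -- `N_{tors} (submodule) ≤ N_tors (subgroup)`
  have htorsle : Nat.card (Submodule.torsion ℤ_[p] N) ≤ Nat.card (AddCommGroup.torsion N) := by
    obtain ⟨m, hm⟩ := ZpCorank.exists_pow_smul_torsion_eq_zero p N
    have hsub : ∀ x : N, x ∈ Submodule.torsion ℤ_[p] N → x ∈ AddCommGroup.torsion N := fun x hx ↦ by
      rw [AddCommGroup.mem_torsion, isOfFinAddOrder_iff_nsmul_eq_zero]
      refine ⟨p ^ m, pow_pos hp.out.pos m, ?_⟩
      have h := hm x hx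
      rwa [← Nat.cast_pow, Nat.cast_smul_eq_nsmul] at h
    obtain ⟨hfin, -⟩ := exists_natCard_torsion_eq_pow p (N := N)
    haveI := hfin
    exact Nat.card_le_card_of_injective
      (fun x : Submodule.torsion ℤ_[p] N ↦ (⟨(x : N), hsub x x.2⟩ : AddCommGroup.torsion N))
      (fun a b h ↦ Subtype.ext (by simpa using congrArg Subtype.val h))
  calc Nat.card S[((p ^ k : ℕ) : ℤ)] = Nat.card (CharacterModule (S[((p ^ k : ℕ) : ℤ)])) :=
        (PontryaginCard.natCard_characterModule_of_finite _).symm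
    _ ≤ Nat.card (ModN (CharacterModule S) (p ^ k)) := Nat.card_le_card_of_surjective r hrsurj
    _ = Nat.card (ModN N (p ^ k)) := Nat.card_congr (modNEquiv Ψ (p ^ k)).symm.toEquiv
    _ ≤ p ^ (k * Module.finrank ℤ_[p] N) * Nat.card (Submodule.torsion ℤ_[p] N) := hle
    _ ≤ p ^ (k * Module.finrank ℤ_[p] N) * Nat.card (AddCommGroup.torsion N) :=
        Nat.mul_le_mul_left _ htorsle

end Algebra

end TamagawaRoad

/-! ## §2 The Tamagawa road at level `p^k` -/

section Pair

variable {V : WeierstrassCurve ℚ} [V.IsElliptic] [V.IsGloballyMinimal] {p : ℕ} [hp : Fact p.Prime]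

/-- **`p^v ∣ #(X_η/TX_η)_tors` whenever `v + k·r ≤ ∑_{ℓ ∈ T} ord_p c_ℓ(W)` and `ord_p c_ℓ(W) ≤ k` on
`T`** (`k ≥ 1`), at a tower-onto pair of rank `r = rank V^{(p*)}(ℚ)`: the level-`p^k` form of the
sibling's §1 (`#Sel⁺(W/ℚ_∞)^Γ[p^k] ≤ p^{k·r} · #(X_η/TX_η)_tors`). CONDITIONAL on the named facts, tower
onto, the `V`-certificate and `coeff_r L_p⁺(V,η,T) ≠ 0`. [cite: Kobayashi2003, Thm. 2.2 (p. 5), Thm. 9.3 (pp. 26–27)]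
[cite: MilneADT2006, Ch. I, Thm. 4.10] [cite: CoatesSchneiderSujatha2003, §3 (30)–(31)] -/
theorem pow_dvd_natCard_torsion_coinvariants_of_namedFacts_of_poitouTate_of_tamagawa_level
    (h12 : Kobayashi2003.thm12_signedSelmerDual_finite_torsion)
    (h13 : Kobayashi2003.thm41_signedCharIdeal_divisibility)
    (h22 : Kobayashi2003.thm22_etaSignedSelmerDual_finite_torsion)
    (h41 : Kobayashi2003.thm41_plusEtaCharIdeal_dvd)
    (hPT : poitouTate_selmerStructure_duality_real ℚ)
    (hp5 : 5 ≤ p) (hgood : V.HasGoodReductionAtPrime p) (hap : V.frobeniusTrace p = 0)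
    (hsurj : ∀ m : ℕ, V.HasSurjectiveModNGaloisRep (p ^ m : ℕ))
    (hcertV : ∀ {N : ℕ} [NeZero N] (f : CuspForm (Gamma0 N) 2), IsNewformOf V f →
      ∃ L : IwasawaAlgebra p, Kobayashi2003.IsSignedPAdicLFunction f p 1 L ∧
        IsUnit (PowerSeries.coeff V.mordellWeilRank L))
    {N : ℕ} [NeZero N] {f : CuspForm (Gamma0 N) 2} (hf : IsNewformOf V f) (ϖ : ℚ)
    (hϖ : if Even (p / 2) then (ϖ : ℝ) * V.realPeriodRat = plusPeriod f
      else (ϖ : ℝ) * V.imaginaryPeriodRat = minusPeriod f)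
    (Lη : IwasawaAlgebra p) (hL : IsQuadraticBranchPlusLFunction f p ϖ Lη)
    (hne : PowerSeries.coeff (V.quadraticTwist ((-1) ^ (p / 2) * p)).mordellWeilRank Lη ≠ 0)
    (W : WeierstrassCurve ℚ) [W.IsElliptic] [W.IsGloballyMinimal] (C : VariableChange ℚ)
    (hCV : C • W.quadraticTwist ((-1) ^ (p / 2) * p) = V)
    (T : Finset (HeightOneSpectrum (𝓞 ℚ)))
    (hpT : (Rat.HeightOneSpectrum.primesEquiv (R := 𝓞 ℚ)).symm ⟨p, hp.out⟩ ∉ T)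
    (hT : ∀ v : HeightOneSpectrum (𝓞 ℚ), v ≠ (Rat.HeightOneSpectrum.primesEquiv (R := 𝓞 ℚ)).symm ⟨p, hp.out⟩ →
      p ∣ (W.baseChange (v.adicCompletion ℚ)).localTamagawaNumber (v.adicCompletionIntegers ℚ) → v ∈ T)
    (k : ℕ) (hk : 1 ≤ k)
    (hTk : ∀ w ∈ T, padicValNat p ((W.baseChange (w.adicCompletion ℚ)).localTamagawaNumber
      (w.adicCompletionIntegers ℚ)) ≤ k)
    (K₀ : Type) [Field K₀] [NumberField K₀] [IsCyclotomicExtension {p} ℚ K₀]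
    [(galRange (K := ℚ) K₀).Normal] (ηq : absoluteGaloisGroup ℚ →* ℤˣ)
    (hηK : ∀ σ ∈ galRange (K := ℚ) K₀, ηq σ = 1) (hη1 : ηq ≠ 1)
    (κ : ZpExtension ℚ p) (γ : absoluteGaloisGroup ℚ) (hκ : κ.IsCyclotomic) (hγ : κ.IsTopGenerator γ)
    (hγK : γ ∈ galRange (K := ℚ) K₀) (hγc : IsCyclotomicVariable p γ)
    (D : EtaSignedSelmerDualData V κ K₀ ℚ_[p] ηq γ 1) (v : ℕ)
    (hv : v + k * (V.quadraticTwist ((-1) ^ (p / 2) * p)).mordellWeilRank ≤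
      ∑ w ∈ T, padicValNat p ((W.baseChange (w.adicCompletion ℚ)).localTamagawaNumber
        (w.adicCompletionIntegers ℚ))) :
    p ^ v ∣ Nat.card (AddCommGroup.torsion (IwasawaAlgebra.coinvariants p D.X)) := by
  have hp2 : p ≠ 2 := by omega
  obtain ⟨hfin, htor⟩ :=
    EtaSignedSelmerDualData.finite_isTorsion_of_thm22 h22 hηK hp2 hgood hap hκ hγ hγK D
  haveI : Module.Finite (IwasawaAlgebra p) D.X := hfin
  obtain ⟨g, hg⟩ := (charIdeal_isPrincipal_holds p D.X).principal
  have hg' : D.charIdeal = Ideal.span {g} := hg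
  obtain ⟨hord, hkfin⟩ :=
    order_eq_twistRank_and_finite_ker_bockstein_of_namedFacts_of_certV_of_coeff_ne_zero h12 h13 h22
      h41 hp5 hgood hap hsurj (fun f hf => hcertV f hf) hf ϖ hϖ Lη hL hne K₀ ηq hηK hη1 κ γ hκ hγ hγK
      hγc D hg'
  have hrank : coinvariantsRank p D.X = (V.quadraticTwist ((-1) ^ (p / 2) * p)).mordellWeilRank := by
    have h := (IwasawaAlgebra.order_charGenerator_eq_coinvariantsRank_iff_finite_ker_bockstein p D.X htor
      g hg').mpr hkfin
    rw [hord] at h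
    exact (ENat.coe_inj.mp h).symm
  obtain ⟨toDualW, hdualW⟩ :=
    TamagawaRoad.exists_isDualPair_strictSigned_of_eta W C hp2 hCV hηK hη1 hκ hγ hγK D
  obtain ⟨Ψ, -⟩ := hdualW.exists_coinvariants_addEquiv
  letI : Module ℤ_[p] (coinvariants p D.X) :=
    Module.compHom _ (algebraMap ℤ_[p] (IwasawaAlgebra p))
  haveI : Module.Finite ℤ_[p] (coinvariants p D.X) := finite_int_coinvariants p D.X
  have hfr : Module.finrank ℤ_[p] (coinvariants p D.X) =
      (V.quadraticTwist ((-1) ^ (p / 2) * p)).mordellWeilRank :=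
    (coinvariantsRank_eq_finrank_int D.X).symm.trans hrank
  obtain ⟨hfinS, hle⟩ :=
    TamagawaRoad.natCard_torsionBy_pow_le_pow_finrank_mul_natCard_torsion p k (coinvariants p D.X) Ψ
  obtain ⟨-, j, hj⟩ := TamagawaRoad.exists_natCard_torsion_eq_pow p (N := coinvariants p D.X)
  rw [hfr, hj, ← pow_add] at hle
  have hcount :=
    TamagawaRoad.prod_pow_padicValNat_localTamagawaNumber_dvd_natCard_localPreimage_inf_torsionBy W p κ k
      hk hp2 hκ C V hCV hgood hap hPT T hpT hT hTk
  rw [TamagawaRoad.natCard_localPreimage_inf_torsionBy_eq κ W hp2 C V hCV hgood hap hγ k,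
    Finset.prod_pow_eq_pow_sum] at hcount
  haveI := hfinS
  have hpos : 0 < Nat.card
      ↥((↥(endInvariants (conjStrictSignedSelmerInfty W κ ℚ_[p] 1 γ - 1)))[((p ^ k : ℕ) : ℤ)]) :=
    Nat.card_pos
  have h1 := (Nat.le_of_dvd hpos hcount).trans hle
  have h2 := (Nat.pow_le_pow_iff_right hp.out.one_lt).mp h1
  rw [hj]
  exact pow_dvd_pow p (by omega)

/-- **THE TAMAGAWA ROAD AT LEVEL `p^k`: (E⁺_η) AT A TOWER-ONTO PAIR OF ANY RANK** from the named facts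
(Kobayashi 1.2/1.3/2.2η/4.1η, Kitajima–Otsuki 1.3η, Poitou–Tate), `p ≥ 5`, tower onto, the
`V`-certificate, the `p*`-partner `W` with `T ∌ (p)` ⊇ every `ℓ ≠ p` with `p ∣ c_ℓ(W)`, `ord_p c_ℓ(W) ≤ k`
on `T` (`k ≥ 1`), the ANALYTIC certificate `p^{v+1} ∤ coeff_r L_p⁺(V,η,T)` and the ARITHMETIC input
**`v + k·r ≤ ∑_{ℓ ∈ T} ord_p c_ℓ(W)`**. CONDITIONAL; closes nothing class-wide; certifies no row.
[cite: Kobayashi2003, Thm. 2.2 (p. 5), Thm. 4.1 and §4 (p. 8)] [cite: KitajimaOtsuki2018, Thm. 1.3]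
[cite: MilneADT2006, Ch. I, Thm. 4.10] [cite: CoatesSchneiderSujatha2003, §3 (30)–(31)] -/
theorem quadraticBranchPlusEtaLowerInclusionAt_of_namedFacts_of_certV_of_poitouTate_of_tamagawa_level
    (h12 : Kobayashi2003.thm12_signedSelmerDual_finite_torsion)
    (h13 : Kobayashi2003.thm41_signedCharIdeal_divisibility)
    (h22 : Kobayashi2003.thm22_etaSignedSelmerDual_finite_torsion)
    (h41 : Kobayashi2003.thm41_plusEtaCharIdeal_dvd)
    (hKO : KitajimaOtsuki2018.mainThm13_etaSignedSelmerDual_noFiniteSubmodule)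
    (hPT : poitouTate_selmerStructure_duality_real ℚ)
    (hp5 : 5 ≤ p) (hgood : V.HasGoodReductionAtPrime p) (hap : V.frobeniusTrace p = 0)
    (hsurj : ∀ m : ℕ, V.HasSurjectiveModNGaloisRep (p ^ m : ℕ))
    (hcertV : ∀ {N : ℕ} [NeZero N] (f : CuspForm (Gamma0 N) 2), IsNewformOf V f →
      ∃ L : IwasawaAlgebra p, Kobayashi2003.IsSignedPAdicLFunction f p 1 L ∧
        IsUnit (PowerSeries.coeff V.mordellWeilRank L))
    (W : WeierstrassCurve ℚ) [W.IsElliptic] [W.IsGloballyMinimal] (C : VariableChange ℚ)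
    (hCV : C • W.quadraticTwist ((-1) ^ (p / 2) * p) = V)
    (T : Finset (HeightOneSpectrum (𝓞 ℚ)))
    (hpT : (Rat.HeightOneSpectrum.primesEquiv (R := 𝓞 ℚ)).symm ⟨p, hp.out⟩ ∉ T)
    (hT : ∀ v : HeightOneSpectrum (𝓞 ℚ), v ≠ (Rat.HeightOneSpectrum.primesEquiv (R := 𝓞 ℚ)).symm ⟨p, hp.out⟩ →
      p ∣ (W.baseChange (v.adicCompletion ℚ)).localTamagawaNumber (v.adicCompletionIntegers ℚ) → v ∈ T)
    (k : ℕ) (hk : 1 ≤ k)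
    (hTk : ∀ w ∈ T, padicValNat p ((W.baseChange (w.adicCompletion ℚ)).localTamagawaNumber
      (w.adicCompletionIntegers ℚ)) ≤ k)
    (v : ℕ)
    (hv : v + k * (V.quadraticTwist ((-1) ^ (p / 2) * p)).mordellWeilRank ≤
      ∑ w ∈ T, padicValNat p ((W.baseChange (w.adicCompletion ℚ)).localTamagawaNumber
        (w.adicCompletionIntegers ℚ)))
    (han : ∀ {N : ℕ} [NeZero N] {f : CuspForm (Gamma0 N) 2}, IsNewformOf V f →
      ∀ (ϖ : ℚ), (if Even (p / 2) then (ϖ : ℝ) * V.realPeriodRat = plusPeriod f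
          else (ϖ : ℝ) * V.imaginaryPeriodRat = minusPeriod f) →
      ∀ (Lη : IwasawaAlgebra p), IsQuadraticBranchPlusLFunction f p ϖ Lη →
        ¬ (p : ℤ_[p]) ^ (v + 1) ∣
          PowerSeries.coeff (V.quadraticTwist ((-1) ^ (p / 2) * p)).mordellWeilRank Lη) :
    QuadraticBranchPlusEtaLowerInclusionAt V p := by
  intro K₀ _ _ _ _ ηq hηK hη1 N _ f hp2 hgood' hap' hf ϖ hϖ Lη hL κ γ hκ hγ hγK hγc D
  obtain ⟨hfin, htor⟩ :=
    EtaSignedSelmerDualData.finite_isTorsion_of_thm22 h22 hηK hp2 hgood' hap' hκ hγ hγK D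
  haveI : Module.Finite (IwasawaAlgebra p) D.X := hfin
  obtain ⟨g, hg⟩ := (charIdeal_isPrincipal_holds p D.X).principal
  have hg' : D.charIdeal = Ideal.span {g} := hg
  obtain ⟨-, hup⟩ := EtaSignedSelmerDualData.thm41_plus_of_facts h22 h41 hηK hη1 hp2 hgood' hap' hf
    ϖ hϖ Lη hL hκ hγ hγK hγc D
  have hgL : g ∣ Lη := by
    have h := hup hsurj
    rw [hg', Ideal.span_singleton_le_span_singleton] at h
    exact h
  have hanL := han hf ϖ hϖ Lη hL
  have hne : PowerSeries.coeff (V.quadraticTwist ((-1) ^ (p / 2) * p)).mordellWeilRank Lη ≠ 0 :=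
    fun h0 => hanL (by rw [h0]; exact dvd_zero _)
  have hXg := X_pow_twistRank_dvd_etaCharGenerator_of_namedFacts_of_certV h12 h13 h22 hp5 hgood hap
    hsurj (fun f hf => hcertV f hf) hf K₀ ηq hηK hη1 κ γ hκ hγ hγK hγc D hg'
  obtain ⟨u, hu⟩ := coeff_twistRank_etaCharGenerator_eq_unit_mul_card_coker_bockstein h12 h13 h22 h41
    hKO hp5 hgood hap hsurj (fun f hf => hcertV f hf) hf ϖ hϖ Lη hL hne K₀ ηq hηK hη1 κ γ hκ hγ hγK hγc
    D hg'
  obtain ⟨-, hdvd⟩ := ker_bockstein_eq_bot_and_natCard_torsion_coinvariants_dvd h12 h13 h22 h41 hKO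
    hp5 hgood hap hsurj (fun f hf => hcertV f hf) hf ϖ hϖ Lη hL hne K₀ ηq hηK hη1 κ γ hκ hγ hγK hγc D
  have htors := pow_dvd_natCard_torsion_coinvariants_of_namedFacts_of_poitouTate_of_tamagawa_level
    h12 h13 h22 h41 hPT hp5 hgood hap hsurj (fun f hf => hcertV f hf) hf ϖ hϖ Lη hL hne W C hCV T hpT hT
    k hk hTk K₀ ηq hηK hη1 κ γ hκ hγ hγK hγc D v hv
  have halg : (p : ℤ_[p]) ^ v ∣
      PowerSeries.coeff (V.quadraticTwist ((-1) ^ (p / 2) * p)).mordellWeilRank g := by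
    rw [hu]
    obtain ⟨c, hc⟩ := htors.trans hdvd
    refine Dvd.dvd.mul_left ?_ _
    rw [hc, Nat.cast_mul, Nat.cast_pow]
    exact dvd_mul_right _ _
  have heq : Ideal.span {g} = Ideal.span {Lη} :=
    span_singleton_eq_of_X_pow_dvd_of_dvd_of_pow_dvd_coeff hXg hgL halg hanL
  rw [← heq, ← hg']

end Pair

end Summit.BirchSwinnertonDyer.BirchSwinnertonDyer.Theorems

end
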